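import Mathlib
import Summits.Ventures.DiscreteObjects.Mahler.TraceLiftMeasure
import Summits.Ventures.DiscreteObjects.Mahler.EngineSoundness

/-!
# Trace polynomials with one complex-conjugate pair of roots — structure (venture `DiscreteObjects`, target L)

Cell `pub-namedobj`, seat `pub-namedobj-mahler` (gen 11). Framing: lottery ticket; floor = certified
bounds/negative ranges.

The Salem certificate (`salem_traceLift_certificate`, gen 10) encloses `M(traceLift Q)` when ALL roots of the
trace polynomial `Q` are real (`ν = 1`: one trace root outside `[-2, 2]`).  Most census cores of degree `10–18`
are not of that type: their trace polynomial has `d - 2` real roots in `(-2, 2)` and ONE complex-conjugate pair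
`y, ȳ` (so `ν = 2` roots `x, x̄` of the core lie outside the unit circle, `x + x⁻¹ = y`).  This file proves the
STRUCTURE theorem behind the kernel certificate `nu2_certificate_of_signs` (file `TraceNu2Certificate`):

* `mahlerMeasure_quad_complex` — for every `y ∈ ℂ`: `M(x² - yx + 1) = r`, `r ≥ 1`,
  `r + r⁻¹ = (|y - 2| + |y + 2|)/2` (the roots `x, x⁻¹` satisfy `|x|·|y ∓ 2| = |x ∓ 1|²`; parallelogram law);
* `exists_root_of_sq_lt_four_mul` — the explicit non-real root of a real quadratic with negative discriminant;
* `nu2_traceLift_certificate` — `Q` monic of degree `d`, `T` = `d - 2` distinct real roots in `(-2, 2)`,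
  `G = ∏_{t∈T}(X - t)`, `H = Q/G` the monic real quadratic cofactor with values `h₊ = H(2)`, `h₋ = H(-2)`
  (so `h₊·G(2) = Q(2)`, `h₋·G(-2) = Q(-2)`); if `(h₋ - h₊)² < 32(h₊ + h₋) - 256` (negative discriminant) the
  remaining roots are `y, ȳ ∉ ℝ` with `h₊ = |y - 2|²`, `h₋ = |y + 2|²`, and `M(traceLift Q) = r²`, `1 < M`,
  `M + M⁻¹ = (h₊ + h₋ + 2√(h₊h₋))/4 - 2`.

Method note (ours, elementary): no root of `Q` is computed in `ℂ`; the complex pair is controlled through the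
real cofactor `H`, whose values at `±2` are quotients of `Q(±2) ∈ ℤ` by products over the certified real roots.
-/

namespace Summit.Ventures.DiscreteObjects.Mahler

open Polynomial

/-! ### The quadratic factor `x² - yx + 1` for complex `y` -/

/-- For every `y ∈ ℂ`: `M(x² - yx + 1) = r` for the real number `r ≥ 1` with
`r + r⁻¹ = (‖y - 2‖ + ‖y + 2‖)/2` (the roots are `x, x⁻¹` with `x + x⁻¹ = y`, `r = max ‖x‖ ‖x⁻¹‖`, and
`‖x‖·‖y ∓ 2‖ = ‖x ∓ 1‖²` with the parallelogram law). -/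
theorem mahlerMeasure_quad_complex (y : ℂ) : ∃ r : ℝ, 1 ≤ r ∧
    (X ^ 2 - C y * X + 1 : ℂ[X]).mahlerMeasure = r ∧ r + r⁻¹ = (‖y - 2‖ + ‖y + 2‖) / 2 := by
  obtain ⟨c, hc⟩ := IsAlgClosed.exists_eq_mul_self (y ^ 2 - 4)
  set x₁ : ℂ := (y + c) / 2 with hx₁
  set x₂ : ℂ := (y - c) / 2 with hx₂
  have hsum : x₁ + x₂ = y := by rw [hx₁, hx₂]; ring
  have hprod : x₁ * x₂ = 1 := by
    have : x₁ * x₂ = (y ^ 2 - c * c) / 4 := by rw [hx₁, hx₂]; ring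
    rw [this, ← hc]; ring
  have hfac : (X ^ 2 - C y * X + 1 : ℂ[X]) = (X - C x₁) * (X - C x₂) := by
    have : (X - C x₁) * (X - C x₂) = X ^ 2 - C (x₁ + x₂) * X + C (x₁ * x₂) := by
      rw [map_add, map_mul]; ring
    rw [this, hsum, hprod, map_one]
  have hx₁0 : x₁ ≠ 0 := by
    intro h; rw [h, zero_mul] at hprod; exact zero_ne_one hprod
  have ha : 0 < ‖x₁‖ := norm_pos_iff.mpr hx₁0
  have hn2 : ‖x₂‖ = ‖x₁‖⁻¹ := by
    have h : ‖x₁‖ * ‖x₂‖ = 1 := by rw [← norm_mul, hprod, norm_one]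
    field_simp; linarith [h]
  have h1 : x₁ * (y - 2) = (x₁ - 1) ^ 2 := by rw [← hsum]; linear_combination hprod
  have h2 : x₁ * (y + 2) = (x₁ + 1) ^ 2 := by rw [← hsum]; linear_combination hprod
  have hn1' : ‖x₁‖ * ‖y - 2‖ = ‖x₁ - 1‖ ^ 2 := by rw [← norm_mul, h1, norm_pow]
  have hn2' : ‖x₁‖ * ‖y + 2‖ = ‖x₁ + 1‖ ^ 2 := by rw [← norm_mul, h2, norm_pow]
  have hpar : ‖x₁ + 1‖ ^ 2 + ‖x₁ - 1‖ ^ 2 = 2 * (‖x₁‖ ^ 2 + ‖(1 : ℂ)‖ ^ 2) :=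
    parallelogram_law_with_norm ℝ x₁ 1
  rw [norm_one, one_pow] at hpar
  have hkey : (‖y - 2‖ + ‖y + 2‖) / 2 = ‖x₁‖ + ‖x₁‖⁻¹ := by
    have : ‖x₁‖ * (‖y - 2‖ + ‖y + 2‖) = 2 * (‖x₁‖ ^ 2 + 1) := by nlinarith [hn1', hn2', hpar]
    field_simp
    nlinarith [this]
  rw [hfac, mahlerMeasure_mul, mahlerMeasure_X_sub_C, mahlerMeasure_X_sub_C, hn2, hkey]
  rcases le_or_gt 1 ‖x₁‖ with h | h
  · refine ⟨‖x₁‖, h, ?_, rfl⟩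
    rw [max_eq_right h, max_eq_left (inv_le_one_of_one_le₀ h), mul_one]
  · refine ⟨‖x₁‖⁻¹, (one_le_inv₀ ha).mpr h.le, ?_, by rw [inv_inv, add_comm]⟩
    rw [max_eq_left h.le, max_eq_right ((one_le_inv₀ ha).mpr h.le), one_mul]


/-! ### Monic real quadratics with a non-real root -/

/-- `b² < 4c`: the explicit non-real root `y = -b/2 + i·√(4c - b²)/2` of `y² + by + c`, with `b = -2 Re y` and
`c = |y|²`. -/
theorem exists_root_of_sq_lt_four_mul {b c : ℝ} (h : b ^ 2 < 4 * c) :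
    ∃ y : ℂ, y.im ≠ 0 ∧ y ^ 2 + (b : ℂ) * y + (c : ℂ) = 0 ∧ b = -2 * y.re ∧ c = Complex.normSq y := by
  set v : ℝ := Real.sqrt (4 * c - b ^ 2) / 2 with hv
  have hv2 : v ^ 2 = (4 * c - b ^ 2) / 4 := by
    rw [hv, div_pow, Real.sq_sqrt (by linarith)]; norm_num
  have hvpos : 0 < v := by rw [hv]; exact div_pos (Real.sqrt_pos.mpr (by linarith)) two_pos
  refine ⟨⟨-b / 2, v⟩, hvpos.ne', ?_, by simp only; ring, ?_⟩
  · apply Complex.ext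
    · simp only [Complex.add_re, Complex.mul_re, Complex.ofReal_re, Complex.ofReal_im, zero_mul, sub_zero,
        Complex.zero_re, sq]
      nlinarith [hv2]
    · simp only [Complex.add_im, Complex.mul_im, Complex.ofReal_re, Complex.ofReal_im, zero_mul, add_zero,
        Complex.zero_im, sq]
      ring
  · rw [Complex.normSq_mk]; nlinarith [hv2]

/-! ### The structure theorem -/

/-- **One complex-conjugate pair of trace roots.**  Let `Q ∈ ℤ[X]` be monic of degree `d` and `T` a set of
`d - 2` distinct real roots of `Q` in `(-2, 2)`; write `G = ∏_{t ∈ T} (X - t)` and let `h₊, h₋` be the reals with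
`h₊ · G(2) = Q(2)`, `h₋ · G(-2) = Q(-2)` (i.e. the values at `±2` of the monic quadratic cofactor `H = Q/G`).
If `(h₋ - h₊)² < 32 (h₊ + h₋) - 256` (equivalently: the discriminant of `H` is negative), then the two remaining
roots of `Q` are a non-real conjugate pair `y, ȳ` with `h₊ = |y - 2|²`, `h₋ = |y + 2|²`, and
`M(traceLift Q) = r²` where `r + r⁻¹ = (|y - 2| + |y + 2|)/2`; consequently `1 < M(traceLift Q)` and
`M + M⁻¹ = (h₊ + h₋ + 2 √(h₊ h₋))/4 - 2`. -/
theorem nu2_traceLift_certificate {Q : ℤ[X]} (hQ : Q.Monic) (T : Multiset ℝ) (hT : T.Nodup)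
    (hcard : Multiset.card T + 2 = Q.natDegree) (hroot : ∀ t ∈ T, aeval t Q = 0)
    (hin : ∀ t ∈ T, -2 < t ∧ t < 2) {hp hm : ℝ}
    (hhp : hp * (T.map (fun t => 2 - t)).prod = aeval (2 : ℝ) Q)
    (hhm : hm * (T.map (fun t => -2 - t)).prod = aeval (-2 : ℝ) Q)
    (hcrit : (hm - hp) ^ 2 < 32 * (hp + hm) - 256) :
    1 < intMahlerMeasure (traceLift Q) ∧
      intMahlerMeasure (traceLift Q) + (intMahlerMeasure (traceLift Q))⁻¹ =
        (hp + hm + 2 * Real.sqrt (hp * hm)) / 4 - 2 := by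
  classical
  -- the real picture: `Q = G · H`
  set Qr : ℝ[X] := Q.map (Int.castRingHom ℝ) with hQr
  have hQrm : Qr.Monic := hQ.map _
  have hQrdeg : Qr.natDegree = Q.natDegree := natDegree_map_eq_of_injective (Int.castRingHom ℝ).injective_int _
  have hQr_eval : ∀ t : ℝ, aeval t Q = Qr.eval t := fun t => by
    rw [hQr, ← algebraMap_int_eq, eval_map_algebraMap]
  set G : ℝ[X] := (T.map fun t => X - C t).prod with hG
  have hGm : G.Monic := monic_multiset_prod_of_monic _ _ fun t _ => monic_X_sub_C t
  have hGdeg : G.natDegree = Multiset.card T := by rw [hG, natDegree_multiset_prod_X_sub_C_eq_card]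
  have hGeval : ∀ u : ℝ, G.eval u = (T.map fun t => u - t).prod := by
    intro u
    rw [hG, eval_multiset_prod, Multiset.map_map]
    exact congrArg _ (Multiset.map_congr rfl fun t _ => by simp)
  have hTle : T ≤ Qr.roots := by
    rw [Multiset.le_iff_subset hT]
    intro t ht
    rw [mem_roots hQrm.ne_zero, IsRoot.def, ← hQr_eval]
    exact hroot t ht
  have hGdvd : G ∣ Qr :=
    calc G = (T.map fun t => X - C t).prod := hG
      _ ∣ (Qr.roots.map fun t => X - C t).prod := Multiset.prod_dvd_prod_of_le (Multiset.map_le_map hTle)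
      _ ∣ Qr := prod_multiset_X_sub_C_dvd Qr
  set H : ℝ[X] := Qr /ₘ G with hH
  have hQGH : Qr = G * H := by
    have h1 := modByMonic_add_div Qr G
    rw [(modByMonic_eq_zero_iff_dvd hGm).mpr hGdvd, zero_add] at h1
    exact h1.symm
  have hHm : H.Monic := hGm.of_mul_monic_left (hQGH ▸ hQrm)
  have hHdeg : H.natDegree = 2 := by
    have := hGm.natDegree_mul hHm
    rw [← hQGH, hQrdeg, hGdeg] at this
    omega
  set b := H.coeff 1 with hb
  set c := H.coeff 0 with hc
  have hHeq : H = X ^ 2 + C b * X + C c := by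
    -- a monic quadratic is `X² + (coeff 1)·X + coeff 0` (cf. `eq_X_sq_add_of_monic_of_natDegree_eq_two` in
    -- `Literature.NumberTheory.EllipticCurves`, not imported here)
    have h := hHm.as_sum
    rw [hHdeg, Finset.sum_range_succ, Finset.sum_range_succ, Finset.sum_range_zero] at h
    rw [h]
    simp only [pow_zero, mul_one, pow_one, zero_add]
    ring
  have hHeval : ∀ u : ℝ, H.eval u = u ^ 2 + b * u + c := by
    intro u; rw [hHeq]; simp
  -- `h₊ = H(2)`, `h₋ = H(-2)`
  have hG2pos : 0 < (T.map fun t => 2 - t).prod :=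
    Multiset.prod_pos fun a ha => by
      obtain ⟨t, ht, rfl⟩ := Multiset.mem_map.mp ha
      linarith [(hin t ht).2]
  have hGm2ne : (T.map fun t => -2 - t).prod ≠ 0 :=
    Multiset.prod_ne_zero fun h0 => by
      obtain ⟨t, ht, h0'⟩ := Multiset.mem_map.mp h0
      linarith [(hin t ht).1]
  have hp_eq : hp = 4 + 2 * b + c := by
    have h1 : Qr.eval 2 = G.eval 2 * H.eval 2 := by rw [hQGH, eval_mul]
    rw [← hQr_eval, ← hhp, hGeval, hHeval, mul_comm] at h1
    have := mul_left_cancel₀ hG2pos.ne' h1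
    rw [this]; ring
  have hm_eq : hm = 4 - 2 * b + c := by
    have h1 : Qr.eval (-2) = G.eval (-2) * H.eval (-2) := by rw [hQGH, eval_mul]
    rw [← hQr_eval, ← hhm, hGeval, hHeval, mul_comm] at h1
    have := mul_left_cancel₀ hGm2ne h1
    rw [this]; ring
  have hdisc : b ^ 2 < 4 * c := by rw [hp_eq, hm_eq] at hcrit; nlinarith [hcrit]
  -- the non-real root `y` of `H`
  obtain ⟨y, hyim, hyroot, hbre, hcnorm⟩ := exists_root_of_sq_lt_four_mul hdisc
  have hp_y : hp = ‖y - 2‖ ^ 2 := by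
    rw [Complex.sq_norm, Complex.normSq_apply, hp_eq, hbre, hcnorm, Complex.normSq_apply]
    simp; ring
  have hm_y : hm = ‖y + 2‖ ^ 2 := by
    rw [Complex.sq_norm, Complex.normSq_apply, hm_eq, hbre, hcnorm, Complex.normSq_apply]
    simp; ring
  -- the complex picture: roots of `Q` over `ℂ` are `T` and `y, ȳ`
  set Qc : ℂ[X] := Q.map (Int.castRingHom ℂ) with hQc
  have hQc_eq : Qc = Qr.map (algebraMap ℝ ℂ) := by
    rw [hQr, Polynomial.map_map]
    exact congrArg (fun f => Q.map f) (RingHom.ext_int _ _)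
  set Hc : ℂ[X] := H.map (algebraMap ℝ ℂ) with hHc
  have hHc_eq : Hc = X ^ 2 + C (b : ℂ) * X + C (c : ℂ) := by
    rw [hHc, hHeq]; simp
  have hHcm : Hc.Monic := hHm.map _
  have hHc_eval : ∀ z : ℂ, Hc.eval z = aeval z H := fun z => by rw [hHc, eval_map_algebraMap]
  have hyr : Hc.IsRoot y := by
    rw [IsRoot.def, hHc_eq]; simp only [eval_add, eval_pow, eval_X, eval_mul, eval_C]; exact hyroot
  have hyr' : Hc.IsRoot (starRingEnd ℂ y) := by
    rw [IsRoot.def, hHc_eval, Polynomial.aeval_conj, ← hHc_eval, hyr.eq_zero, map_zero]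
  have hne : starRingEnd ℂ y ≠ y := by rw [Ne, Complex.conj_eq_iff_im]; exact hyim
  have hHcroots : Hc.roots = {y, starRingEnd ℂ y} := by
    symm
    apply Multiset.eq_of_le_of_card_le
    · rw [Multiset.le_iff_subset (by simp [hne.symm])]
      intro z hz
      simp only [Multiset.insert_eq_cons, Multiset.mem_cons, Multiset.mem_singleton] at hz
      rcases hz with rfl | rfl
      · exact (mem_roots hHcm.ne_zero).mpr hyr
      · exact (mem_roots hHcm.ne_zero).mpr hyr'
    · calc Multiset.card Hc.roots ≤ Hc.natDegree := card_roots' Hc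
        _ = 2 := by rw [hHc, natDegree_map_eq_of_injective (algebraMap ℝ ℂ).injective, hHdeg]
        _ = Multiset.card ({y, starRingEnd ℂ y} : Multiset ℂ) := by simp
  have hGcroots : (G.map (algebraMap ℝ ℂ)).roots = T.map (fun t : ℝ => (t : ℂ)) := by
    have : G.map (algebraMap ℝ ℂ) = ((T.map (fun t : ℝ => (t : ℂ))).map fun a => X - C a).prod := by
      rw [hG, Polynomial.map_multiset_prod, Multiset.map_map, Multiset.map_map]
      exact congrArg _ (Multiset.map_congr rfl fun t _ => by simp)
    rw [this, roots_multiset_prod_X_sub_C]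
  have hQcroots : Qc.roots = T.map (fun t : ℝ => (t : ℂ)) + {y, starRingEnd ℂ y} := by
    have hne0 : G.map (algebraMap ℝ ℂ) * Hc ≠ 0 := by
      rw [hHc, ← Polynomial.map_mul, ← hQGH, ← hQc_eq]
      exact (Polynomial.map_ne_zero_iff (Int.castRingHom ℂ).injective_int).mpr hQ.ne_zero
    rw [hQc_eq, hQGH, Polynomial.map_mul, roots_mul hne0, hGcroots, hHcroots]
  -- the Mahler measure
  obtain ⟨r, hr1, hry, hrA⟩ := mahlerMeasure_quad_complex y
  obtain ⟨r', hr1', hry', hrA'⟩ := mahlerMeasure_quad_complex (starRingEnd ℂ y)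
  have hAA : ‖starRingEnd ℂ y - 2‖ + ‖starRingEnd ℂ y + 2‖ = ‖y - 2‖ + ‖y + 2‖ := by
    have e1 : starRingEnd ℂ y - 2 = starRingEnd ℂ (y - 2) := by rw [map_sub, map_ofNat]
    have e2 : starRingEnd ℂ y + 2 = starRingEnd ℂ (y + 2) := by rw [map_add, map_ofNat]
    rw [e1, e2, Complex.norm_conj, Complex.norm_conj]
  have hrr : r' = r := by
    rw [hAA, ← hrA] at hrA'
    rcases lt_trichotomy r' r with h | h | h
    · exact absurd hrA' (ne_of_lt (add_inv_lt_add_inv hr1' h))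
    · exact h
    · exact absurd hrA'.symm (ne_of_lt (add_inv_lt_add_inv hr1 h))
  have hM : intMahlerMeasure (traceLift Q) = r * r := by
    rw [intMahlerMeasure_traceLift hQ, ← hQc, hQcroots, Multiset.map_add, Multiset.prod_add, Multiset.map_map]
    have h1 : (T.map ((fun u : ℂ => (X ^ 2 - C u * X + 1 : ℂ[X]).mahlerMeasure) ∘ fun t : ℝ => (t : ℂ))).prod = 1 :=
      Multiset.prod_eq_one fun m hm' => by
        obtain ⟨t, ht, rfl⟩ := Multiset.mem_map.mp hm'
        exact mahlerMeasure_quad_of_abs_le_two (abs_le.mpr ⟨(hin t ht).1.le, (hin t ht).2.le⟩)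
    rw [h1, one_mul, Multiset.insert_eq_cons, Multiset.map_cons, Multiset.prod_cons, Multiset.map_singleton,
      Multiset.prod_singleton, hry, hry', hrr]
  -- `r + r⁻¹ > 2`, so `r > 1`
  have hA : 2 < (‖y - 2‖ + ‖y + 2‖) / 2 := by
    have h1 : |y.re - 2| < ‖y - 2‖ := by
      refine lt_of_pow_lt_pow_left₀ 2 (norm_nonneg _) ?_
      rw [Complex.sq_norm, Complex.normSq_apply, sq_abs]
      simp only [Complex.sub_re, Complex.re_ofNat, Complex.sub_im, Complex.im_ofNat, sub_zero]
      nlinarith [mul_self_pos.mpr hyim]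
    have h2 : |y.re + 2| ≤ ‖y + 2‖ := by
      have := Complex.abs_re_le_norm (y + 2)
      simpa using this
    have h3 : (4 : ℝ) ≤ |y.re - 2| + |y.re + 2| := by
      have := abs_sub (y.re + 2) (y.re - 2)
      rw [show y.re + 2 - (y.re - 2) = (4 : ℝ) by ring, abs_of_pos (by norm_num : (0:ℝ) < 4)] at this
      linarith
    linarith
  have hr : 1 < r := by
    by_contra hle
    have : r = 1 := le_antisymm (not_lt.mp hle) hr1
    rw [← hrA, this] at hA
    norm_num at hA
  refine ⟨by rw [hM]; nlinarith, ?_⟩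
  -- `M + M⁻¹ = (r + r⁻¹)² - 2 = A² - 2`
  have hr0 : r ≠ 0 := by positivity
  have hsq : Real.sqrt (hp * hm) = ‖y - 2‖ * ‖y + 2‖ := by
    rw [hp_y, hm_y, ← mul_pow, Real.sqrt_sq (by positivity)]
  rw [hM, hsq, hp_y, hm_y]
  have : r * r + (r * r)⁻¹ = (r + r⁻¹) ^ 2 - 2 := by field_simp; ring
  rw [this, hrA]
  ring


end Summit.Ventures.DiscreteObjects.Mahler
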